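import Mathlib.RingTheory.AdjoinRoot
import Mathlib.RingTheory.LocalRing.LocalSubring
import Mathlib.RingTheory.DiscreteValuationRing.TFAE
import Mathlib.RingTheory.Localization.Integral
import Mathlib.RingTheory.Localization.Submodule
import Mathlib.RingTheory.Valuation.ValuationRing
import Mathlib.FieldTheory.Minpoly.Field
import Literature.NumberTheory.DiophantineGeometry.FunctionFieldDivisors
import HarnessLib

/-!
# F. K. Schmidt's theorem `∂ = 1` — proof file 2: places of `F(α)` above a place of `F`
(Kummer's theorem, Stichtenoth Thm. 3.3.7, for a simple root)

Sibling **proof file** (theorems only; D-0014) of `FunctionFieldSchmidtDegreeOne` (named fact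
`minPosDegree_eq_one` = **Stichtenoth Cor. 5.1.11**, F. K. Schmidt's `∂ = 1`). The printed proof of
Cor. 5.1.11 (H. Stichtenoth, *Algebraic Function Fields and Codes*, 2nd ed., GTM 254, §5.1) rests
on Lemma 5.1.9 (d): in the constant field extension `F𝔽_{q^r}/F` a place of degree `m` splits into
`gcd(m, r)` places — a consequence of Kummer's theorem (Thm. 3.3.7) and of the theory of §3.6. The
tree has places, divisors and the Riemann–Roch theorem of a single function field `F/K`
(`FunctionFieldDivisors` … `FunctionFieldAdelesProofs`) but no extensions `F'/F` of function
fields. This file proves the one piece of that theory which the discharge of `∂ = 1`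
(`FunctionFieldSchmidtDegreeOneProofs`) needs, in a self-contained form:

* `exists_valuationSubring_over_of_isRoot` — **Kummer's theorem for a simple root**
  (Thm. 3.3.7 with `γ_i(T) = T - ā` a simple linear factor of `μ̄`): for a place `P` of `F/K`,
  a monic `μ ∈ K[T]` irreducible over `F`, `F' = F(α)` with `μ(α) = 0`, and a simple root
  `ā ∈ 𝒪_P/P` of `μ̄` with lift `a ∈ 𝒪_P`, there is a valuation ring `𝒪'` of `F'` with
  `𝒪' ∩ F = 𝒪_P`, `α - a ∈ 𝔪(𝒪')`, and `𝒪_P → 𝒪'/𝔪(𝒪')` surjective (residue degree one).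

The printed proof obtains a place `P_i ⊇ Ker σ_i` from Thm. 1.1.19 (Chevalley) and the residue
degree from the fundamental equality `∑ e_i f_i = n` (Thm. 3.1.11), which is not in the tree.
Here instead (standard, Hensel-free): with `R = 𝒪_P[α] ⊆ F'`, the reduction
`σ : R → 𝒪_P/P`, `∑ c_j α^j ↦ ∑ c̄_j ā^j` (well defined because `Ker (𝒪_P[T] → F') = μ 𝒪_P[T]`,
exactly as in the printed proof) and `𝔭 = Ker σ`, the localisation `R_𝔭 ⊆ F'` is a Noetherian
local domain whose maximal ideal is generated by a prime element `t` of `P` — from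
`μ = (T - a)ν + μ(a)`, `μ(a) ∈ t𝒪_P` and `ν̄(ā) = μ̄'(ā) ≠ 0` one gets `α - a = -μ(a)/ν(α) ∈ t R_𝔭` —
hence a discrete valuation ring (Mathlib `IsDiscreteValuationRing.TFAE`), and `𝒪' := R_𝔭` has
residue ring `R/𝔭 = 𝒪_P/P`.

Mathlib ingredients: `LocalSubring.ofPrime` (localisation of a subring of a field at a prime, with
its `IsLocalization.AtPrime` instance), `RingHom.liftOfSurjective`, `IsDiscreteValuationRing.TFAE`,
`ValuationRing.isInteger_or_isInteger`, `IsLocalization.integerNormalization`, `minpoly.dvd`.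
No definitions; the valuation ring is produced as an existential statement.

## References

* H. Stichtenoth, *Algebraic Function Fields and Codes*, 2nd ed., GTM 254, Springer 2009, §3.3,
  Thm. 3.3.7 (Kummer) and its proof (pp. 86–88; held copy
  `book:stichtenothnd-algebraic-function-fields-codes`, text pp. 79–82); §5.1 Lemma 5.1.9,
  Cor. 5.1.11. [Stichtenoth2009]
-/

noncomputable section


open Polynomial

namespace Literature.NumberTheory.DiophantineGeometry.AlgFunctionField

universe u v w

variable {K : Type u} {F : Type v} [Field K] [Field F] [Algebra K F]
variable {F' : Type w} [Field F'] [Algebra F F']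

/-- A Noetherian local subring `L` of a field `F'` whose maximal ideal is principal and nonzero,
and such that every element of `F'` is a quotient of elements of `L`, is a valuation ring of `F'`:
every `z ∈ F'` satisfies `z ∈ L` or `z⁻¹ ∈ L` (Noetherian local domains with principal maximal
ideal are discrete valuation rings). [folklore] -/
theorem mem_or_inv_mem_of_maximalIdeal_eq_span (L : Subring F') [IsLocalRing L]
    [IsNoetherianRing L] {ϖ : L} (hϖ0 : ϖ ≠ 0)
    (hmax : IsLocalRing.maximalIdeal L = Ideal.span {ϖ})
    (hfrac : ∀ z : F', ∃ x y : L, z = x / y) (z : F') : z ∈ L ∨ z⁻¹ ∈ L := by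
  have hnf : ¬ IsField L := by
    rw [IsLocalRing.isField_iff_maximalIdeal_eq, hmax, Ideal.span_singleton_eq_bot]
    exact hϖ0
  have hprinc : (IsLocalRing.maximalIdeal L).IsPrincipal := ⟨⟨ϖ, hmax⟩⟩
  have hval : ValuationRing L := ((IsDiscreteValuationRing.TFAE L hnf).out 1 4).mpr hprinc
  haveI : IsFractionRing L F' :=
    IsFractionRing.of_field L F' (fun z => by
      obtain ⟨x, y, h⟩ := hfrac z
      exact ⟨x, y, h⟩)
  rcases ValuationRing.isInteger_or_isInteger L z with ⟨x, hx⟩ | ⟨x, hx⟩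
  · exact Or.inl (hx ▸ x.2)
  · exact Or.inr (hx ▸ x.2)

/-- **Kummer's theorem for a simple root (Stichtenoth Thm. 3.3.7, the case `deg γ_i = 1`,
`ε_i = 1`): places of `F(α)` over `P` from simple roots of the reduced polynomial.**
Let `P` be a place of `F/K` with valuation ring `𝒪_P`, let `μ ∈ K[T]` be monic and irreducible
over `F`, let `F' = F(α)` with `μ(α) = 0`, and let `ā ∈ 𝒪_P/P` be a simple root of `μ̄`, with a
lift `a ∈ 𝒪_P`. Then there is a valuation ring `𝒪'` of `F'` with `𝒪' ∩ F = 𝒪_P`, `α - a` a non-unit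
of `𝒪'`, and every residue class of `𝒪'` represented by an element of `𝒪_P` — i.e. a place
`P' | P` of `F'` with `α - a ∈ P'` and residue degree `f(P'|P) = 1`.
Proof (without Hensel's lemma or the fundamental equality): with `R = 𝒪_P[α]`,
`σ : R → 𝒪_P/P`, `∑ cⱼ αʲ ↦ ∑ c̄ⱼ āʲ` (well defined since `Ker (𝒪_P[T] → F')` is generated by `μ`,
as in the printed proof of Thm. 3.3.7) and `𝔭 = Ker σ`, the local ring `R_𝔭 ⊆ F'` has maximal
ideal generated by a prime element `t` of `P`: writing `μ = (T - a) ν + μ(a)` one has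
`μ(a) ∈ P = t𝒪_P` and `ν(α) ∉ 𝔭` (as `ν̄(ā) = μ̄'(ā) ≠ 0`), so `α - a = -μ(a) ν(α)⁻¹ ∈ t R_𝔭`; hence
the Noetherian local domain `R_𝔭` is a discrete valuation ring of `F'`, and `𝒪' := R_𝔭`.
[cite: Stichtenoth2009, Thm. 3.3.7 (proof)] -/
theorem exists_valuationSubring_over_of_isRoot {μ : K[X]} (hμm : μ.Monic)
    (hirr : Irreducible (μ.map (algebraMap K F))) {α : F'}
    (hα : aeval α (μ.map (algebraMap K F)) = 0) (hgen : ∀ z : F', ∃ p : F[X], aeval α p = z)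
    (P : PlaceOver K F) (a : P.toValuationSubring)
    (ha : aeval (IsLocalRing.residue P.toValuationSubring a) μ = 0)
    (ha' : aeval (IsLocalRing.residue P.toValuationSubring a) (derivative μ) ≠ 0) :
    ∃ V : ValuationSubring F', V ≠ ⊤ ∧
      (∀ x : F, algebraMap F F' x ∈ V ↔ x ∈ P.toValuationSubring) ∧
      α - algebraMap F F' (a : F) ∈ V.nonunits ∧
      ∀ y ∈ V, ∃ x : P.toValuationSubring, y - algebraMap F F' (x : F) ∈ V.nonunits := by
  classical
  -- ### the prime element `ϖ` of `O = 𝒪_P` and the residue map `res : O → κ`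
  have hϖirr : Irreducible P.uniformizer := P.irreducible_uniformizer
  have hmaxO : IsLocalRing.maximalIdeal P.toValuationSubring = Ideal.span {P.uniformizer} :=
    hϖirr.maximalIdeal_eq
  have hϖ0 : (P.uniformizer : F) ≠ 0 := fun h => hϖirr.ne_zero (Subtype.ext h)
  have hmem_span : ∀ y : P.toValuationSubring, y ∈ IsLocalRing.maximalIdeal P.toValuationSubring →
      ∃ c : P.toValuationSubring, y = P.uniformizer * c := fun y hy => by
    rw [hmaxO, Ideal.mem_span_singleton'] at hy
    obtain ⟨c, hc⟩ := hy
    exact ⟨c, by rw [← hc, mul_comm]⟩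
  set res := IsLocalRing.residue P.toValuationSubring with hres
  -- ### the ring `R = O[α] ⊆ F'`
  set ι : P.toValuationSubring →+* F' :=
    (algebraMap F F').comp (algebraMap P.toValuationSubring F) with hι
  have hιapply : ∀ x : P.toValuationSubring, ι x = algebraMap F F' (x : F) := fun x => rfl
  have hι0 : ι P.uniformizer ≠ 0 := by rw [hιapply, _root_.map_ne_zero]; exact hϖ0
  set e : (P.toValuationSubring)[X] →+* F' := eval₂RingHom ι α with he
  have he_C : ∀ x : P.toValuationSubring, e (C x) = ι x := fun x => by simp [he]
  have he_X : e X = α := by simp [he]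
  set R : Subring F' := e.range with hR
  set eR : (P.toValuationSubring)[X] →+* R := e.rangeRestrict with heR
  have heR_apply : ∀ p, ((eR p : R) : F') = e p := fun p => rfl
  have heR_surj : Function.Surjective eR := e.rangeRestrict_surjective
  -- ### `μ` over `O`; `e μ_O = 0`
  set μO : (P.toValuationSubring)[X] := μ.map (algebraMap K P.toValuationSubring) with hμO
  have hμOm : μO.Monic := hμm.map _
  have hμF_eq : μ.map (algebraMap K F) = μO.map (algebraMap P.toValuationSubring F) := by
    rw [hμO, Polynomial.map_map]; rfl
  have hmin : minpoly F α = μ.map (algebraMap K F) :=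
    (minpoly.eq_of_irreducible_of_monic hirr hα (hμm.map _)).symm
  have he_map : ∀ q : (P.toValuationSubring)[X],
      e q = aeval α (q.map (algebraMap P.toValuationSubring F)) := fun q => by
    rw [he, coe_eval₂RingHom, aeval_def, eval₂_map, hι]
  have heμO : e μO = 0 := by rw [he_map, ← hμF_eq, hα]
  -- ### `Ker e` is generated by `μ_O` (monic division)
  have hdiv : ∀ p : (P.toValuationSubring)[X], e p = 0 → μO ∣ p := by
    intro p hp
    rw [← modByMonic_eq_zero_iff_dvd hμOm]
    have heq : e (p %ₘ μO) = 0 := by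
      have h1 := modByMonic_add_div p μO
      apply_fun e at h1
      rwa [map_add, map_mul, heμO, zero_mul, add_zero, hp] at h1
    have hinj := IsFractionRing.injective P.toValuationSubring F
    have hqF : μ.map (algebraMap K F) ∣ (p %ₘ μO).map (algebraMap P.toValuationSubring F) := by
      rw [← hmin]; apply minpoly.dvd; rw [← he_map, heq]
    have hdeg : ((p %ₘ μO).map (algebraMap P.toValuationSubring F)).degree <
        (μ.map (algebraMap K F)).degree := by
      rw [degree_map_eq_of_injective hinj, hμF_eq, degree_map_eq_of_injective hinj]
      exact degree_modByMonic_lt p hμOm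
    have h0 := eq_zero_of_dvd_of_degree_lt hqF hdeg
    rwa [Polynomial.map_eq_zero_iff hinj] at h0
  -- ### the reduction `ρ : O[T] → κ`, `p ↦ p̄(ā)`, kills `Ker e`
  set ρ : (P.toValuationSubring)[X] →+* IsLocalRing.ResidueField P.toValuationSubring :=
    eval₂RingHom res (res a) with hρ
  have hρ_eval : ∀ p, ρ p = res (p.eval a) := fun p => by
    simp only [hρ, coe_eval₂RingHom]
    exact eval₂_at_apply res a
  have hρ_map : ∀ q : K[X], ρ (q.map (algebraMap K P.toValuationSubring)) = aeval (res a) q :=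
    fun q => by
      rw [hρ, coe_eval₂RingHom, eval₂_map, aeval_def]
      rfl
  have hρμO : ρ μO = 0 := by rw [hμO, hρ_map, ha]
  have hker : RingHom.ker eR ≤ RingHom.ker ρ := by
    intro p hp
    rw [RingHom.mem_ker] at hp ⊢
    have hp' : e p = 0 := by rw [← heR_apply, hp]; rfl
    obtain ⟨q, rfl⟩ := hdiv p hp'
    rw [map_mul, hρμO, zero_mul]
  -- ### `φ : R → κ` and its kernel `𝔭`
  set φ : R →+* IsLocalRing.ResidueField P.toValuationSubring :=
    eR.liftOfSurjective heR_surj ⟨ρ, hker⟩ with hφ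
  have hφ_apply : ∀ p, φ (eR p) = ρ p := fun p =>
    eR.liftOfSurjective_comp_apply heR_surj ⟨ρ, hker⟩ p
  set 𝔭 : Ideal R := RingHom.ker φ with h𝔭
  haveI h𝔭p : 𝔭.IsPrime := RingHom.ker_isPrime φ
  have hmemker : ∀ z : R, z ∈ 𝔭 ↔ φ z = 0 := fun z => RingHom.mem_ker
  have hmem𝔭 : ∀ p, eR p ∈ 𝔭 ↔ p.eval a ∈ IsLocalRing.maximalIdeal P.toValuationSubring :=
    fun p => by rw [hmemker, hφ_apply, hρ_eval, IsLocalRing.residue_eq_zero_iff]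
  -- ### the local ring `L = R_𝔭 ⊆ F'`
  set L : Subring F' := (LocalSubring.ofPrime R 𝔭).toSubring with hL
  have hRL : R ≤ L := LocalSubring.le_ofPrime R 𝔭
  have halg : ∀ r : R, ((algebraMap R L r : L) : F') = (r : F') := fun r => rfl
  haveI : IsNoetherianRing R := isNoetherianRing_of_surjective _ R eR heR_surj
  haveI : IsNoetherianRing L := IsLocalization.isNoetherianRing 𝔭.primeCompl L inferInstance
  -- the prime element in `L`
  set ϖL : L := algebraMap R L (eR (C P.uniformizer)) with hϖL
  have hϖL_coe : ((ϖL : L) : F') = ι P.uniformizer := by rw [hϖL, halg, heR_apply, he_C]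
  have hϖL0 : ϖL ≠ 0 := by
    intro h
    have : ((ϖL : L) : F') = 0 := by rw [h]; rfl
    exact hι0 (hϖL_coe ▸ this)
  have hϖR_mem : eR (C P.uniformizer) ∈ 𝔭 := by
    rw [hmem𝔭, eval_C, hmaxO]; exact Ideal.mem_span_singleton_self _
  have hϖL_mem : ϖL ∈ IsLocalRing.maximalIdeal L :=
    (IsLocalization.AtPrime.to_map_mem_maximal_iff L 𝔭 _).mpr hϖR_mem
  have hϖL_not_unit : ¬ IsUnit ϖL := (IsLocalRing.mem_maximalIdeal _).mp hϖL_mem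
  -- ### key step: `α - a ∈ ϖ L`
  have hμO_split : μO = (X - C a) * (μO /ₘ (X - C a)) + C (μO.eval a) := by
    have h1 := modByMonic_add_div μO (X - C a)
    rw [modByMonic_X_sub_C_eq_C_eval] at h1
    exact h1.symm.trans (add_comm _ _)
  have hμOa : μO.eval a ∈ IsLocalRing.maximalIdeal P.toValuationSubring := by
    rw [← IsLocalRing.residue_eq_zero_iff, ← hρ_eval]; exact hρμO
  obtain ⟨c₀, hc₀⟩ := hmem_span _ hμOa
  have hν_not_mem : eR (μO /ₘ (X - C a)) ∉ 𝔭 := by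
    rw [hmemker, hφ_apply, hρ_eval]
    have hνa : (μO /ₘ (X - C a)).eval a = (derivative μO).eval a := by
      conv_rhs => rw [hμO_split]
      simp
    rw [hνa, ← hρ_eval, hμO, derivative_map, hρ_map]
    exact ha'
  obtain ⟨u, hu⟩ := IsLocalization.map_units L (⟨eR (μO /ₘ (X - C a)), hν_not_mem⟩ : 𝔭.primeCompl)
  have hαa_L : algebraMap R L (eR X - eR (C a)) ∈ Ideal.span {ϖL} := by
    have h2 : eR μO = 0 := Subtype.ext (by rw [heR_apply, heμO]; rfl)
    rw [hμO_split, hc₀, C_mul] at h2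
    simp only [map_add, map_mul, map_sub] at h2
    have h3 : (eR X - eR (C a)) * eR (μO /ₘ (X - C a)) =
        -(eR (C P.uniformizer) * eR (C c₀)) := eq_neg_of_add_eq_zero_left h2
    have h4 := congrArg (algebraMap R L) h3
    rw [map_mul, map_neg, map_mul] at h4
    have h5 : algebraMap R L (eR X - eR (C a)) =
        -(ϖL * algebraMap R L (eR (C c₀))) * ↑u⁻¹ := by
      rw [hϖL, ← h4, ← hu, mul_assoc, Units.mul_inv, mul_one]
    rw [h5]
    exact Ideal.mul_mem_right _ _ (Submodule.neg_mem _
      (Ideal.mul_mem_right _ _ (Ideal.mem_span_singleton_self _)))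
  -- ### the maximal ideal of `L` is `ϖ L`
  have hmaxL : IsLocalRing.maximalIdeal L = Ideal.span {ϖL} := by
    apply le_antisymm
    · intro m hm
      obtain ⟨r, s, rfl⟩ := IsLocalization.exists_mk'_eq 𝔭.primeCompl m
      have hr : r ∈ 𝔭 := (IsLocalization.AtPrime.mk'_mem_maximal_iff L 𝔭 r s).mp hm
      rw [IsLocalization.mk'_eq_mul_mk'_one]
      refine Ideal.mul_mem_right _ _ ?_
      obtain ⟨p, rfl⟩ := heR_surj r
      obtain ⟨c, hc⟩ := hmem_span _ ((hmem𝔭 p).mp hr)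
      have hp_split : p = (X - C a) * (p /ₘ (X - C a)) + C (P.uniformizer * c) := by
        have h1 := modByMonic_add_div p (X - C a)
        rw [modByMonic_X_sub_C_eq_C_eval, hc] at h1
        exact h1.symm.trans (add_comm _ _)
      rw [hp_split, C_mul]
      simp only [map_add, map_mul, map_sub]
      refine Ideal.add_mem _ (Ideal.mul_mem_right _ _ hαa_L)
        (Ideal.mul_mem_right _ _ (Ideal.mem_span_singleton_self _))
    · rw [Ideal.span_le, Set.singleton_subset_iff]; exact hϖL_mem
  -- ### every element of `F'` is a quotient of elements of `R ⊆ L`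
  have hfrac : ∀ z : F', ∃ x y : L, z = x / y := by
    intro z
    obtain ⟨p, rfl⟩ := hgen z
    obtain ⟨b, hb, hbp⟩ :=
      IsLocalization.integerNormalization_spec (nonZeroDivisors P.toValuationSubring) p
    have hb0 : ι b ≠ 0 := by
      rw [map_ne_zero_iff ι ((algebraMap F F').injective.comp
        (IsFractionRing.injective P.toValuationSubring F))]
      exact nonZeroDivisors.ne_zero hb
    refine ⟨⟨e (IsLocalization.integerNormalization (nonZeroDivisors P.toValuationSubring) p),
      hRL ⟨_, rfl⟩⟩, ⟨ι b, hRL ⟨C b, he_C b⟩⟩, ?_⟩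
    change aeval α p =
      e (IsLocalization.integerNormalization (nonZeroDivisors P.toValuationSubring) p) / ι b
    rw [eq_div_iff hb0, he_map, hbp, Algebra.smul_def, Polynomial.algebraMap_apply, map_mul,
      aeval_C]
    exact mul_comm _ _
  -- ### `L` is a valuation ring `V` of `F'`
  have hmem_or : ∀ z : F', z ∈ L ∨ z⁻¹ ∈ L :=
    mem_or_inv_mem_of_maximalIdeal_eq_span L hϖL0 hmaxL hfrac
  let V : ValuationSubring F' := { L with mem_or_inv_mem' := hmem_or }
  have hVL : ∀ z : F', z ∈ V ↔ z ∈ L := fun z => Iff.rfl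
  have hnon : ∀ (z : F') (hz : z ∈ L),
      z ∈ V.nonunits ↔ (⟨z, hz⟩ : L) ∈ IsLocalRing.maximalIdeal L := by
    intro z hz
    rw [ValuationSubring.mem_nonunits_iff_exists_mem_maximalIdeal]
    constructor
    · intro h
      obtain ⟨_, h'⟩ := h
      exact h'
    · intro h
      exact ⟨hz, h⟩
  have hunitL : ∀ w : L, ((ϖL : L) : F') * (w : F') = 1 → False := fun w hw =>
    hϖL_not_unit (IsUnit.of_mul_eq_one w (Subtype.ext hw))
  refine ⟨V, ?_, ?_, ?_, ?_⟩
  · -- `V ≠ F'`: `ϖ` is not a unit of `V`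
    intro hV
    have hinv : (ι P.uniformizer)⁻¹ ∈ L := (hVL _).mp (hV ▸ ValuationSubring.mem_top _)
    exact hunitL ⟨_, hinv⟩ (by rw [hϖL_coe]; exact mul_inv_cancel₀ hι0)
  · -- `V ∩ F = 𝒪_P`
    intro x
    constructor
    · intro hx
      by_contra hxO
      have hx0 : x ≠ 0 := by rintro rfl; exact hxO (zero_mem _)
      have hxinv : x⁻¹ ∈ P.toValuationSubring :=
        (P.toValuationSubring.mem_or_inv_mem x).resolve_left hxO
      have hxmax : (⟨x⁻¹, hxinv⟩ : P.toValuationSubring) ∈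
          IsLocalRing.maximalIdeal P.toValuationSubring := by
        rw [IsLocalRing.mem_maximalIdeal, mem_nonunits_iff]
        rintro ⟨w, hw⟩
        apply hxO
        have h1 : ((w⁻¹ : (P.toValuationSubring)ˣ) : P.toValuationSubring) * ⟨x⁻¹, hxinv⟩ = 1 := by
          rw [← hw, Units.inv_mul]
        have h2 : (((w⁻¹ : (P.toValuationSubring)ˣ) : P.toValuationSubring) : F) * x⁻¹ = 1 :=
          congrArg Subtype.val h1
        have h3 : (((w⁻¹ : (P.toValuationSubring)ˣ) : P.toValuationSubring) : F) = x :=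
          (mul_inv_eq_one₀ hx0).mp h2
        rw [← h3]
        exact Subtype.mem _
      obtain ⟨c, hc⟩ := hmem_span _ hxmax
      have hcL : ι c * algebraMap F F' x ∈ L :=
        mul_mem (hRL ⟨C c, he_C c⟩) ((hVL _).mp hx)
      refine hunitL ⟨_, hcL⟩ ?_
      rw [hϖL_coe, ← mul_assoc, ← map_mul, show P.uniformizer * c = ⟨x⁻¹, hxinv⟩ from
        hc.symm, hιapply, ← map_mul]
      change algebraMap F F' (x⁻¹ * x) = 1
      rw [inv_mul_cancel₀ hx0, map_one]
    · intro hx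
      exact hRL ⟨C ⟨x, hx⟩, he_C _⟩
  · -- `α - a ∈ P'`
    have heXa : e (X - C a) = α - algebraMap F F' (a : F) := by
      rw [map_sub, he_X, he_C, hιapply]
    have hmem : α - algebraMap F F' (a : F) ∈ L := hRL ⟨X - C a, heXa⟩
    rw [hnon _ hmem, hmaxL]
    have key : (⟨α - algebraMap F F' (a : F), hmem⟩ : L) = algebraMap R L (eR X - eR (C a)) := by
      apply Subtype.ext
      rw [halg]
      change α - algebraMap F F' (a : F) = e X - e (C a)
      rw [he_X, he_C, hιapply]
    rw [key]
    exact hαa_L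
  · -- residue classes are represented by `𝒪_P`
    intro y hy
    obtain ⟨r, s, hrs⟩ := IsLocalization.exists_mk'_eq 𝔭.primeCompl (⟨y, hy⟩ : L)
    have hs : φ (s : R) ≠ 0 := fun h => absurd ((hmemker _).mpr h) s.2
    obtain ⟨x, hx⟩ := Ideal.Quotient.mk_surjective
      (I := IsLocalRing.maximalIdeal P.toValuationSubring) (φ r * (φ (s : R))⁻¹)
    refine ⟨x, ?_⟩
    have hdiff : r - eR (C x) * (s : R) ∈ 𝔭 := by
      have hx' : res x = φ r * (φ (s : R))⁻¹ := hx
      rw [hmemker, map_sub, map_mul, hφ_apply, hρ_eval, eval_C, hx',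
        inv_mul_cancel_right₀ hs, sub_self]
    have hmaxmem : IsLocalization.mk' L r s - algebraMap R L (eR (C x)) ∈
        IsLocalRing.maximalIdeal L := by
      have h1 : (IsLocalization.mk' L r s - algebraMap R L (eR (C x))) * algebraMap R L (s : R) =
          algebraMap R L (r - eR (C x) * (s : R)) := by
        rw [sub_mul, IsLocalization.mk'_spec, map_sub, map_mul]
      have h2 : algebraMap R L (r - eR (C x) * (s : R)) ∈ IsLocalRing.maximalIdeal L :=
        (IsLocalization.AtPrime.to_map_mem_maximal_iff L 𝔭 _).mpr hdiff
      rw [← h1] at h2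
      exact (Ideal.IsPrime.mem_or_mem inferInstance h2).resolve_right
        (fun h => (IsLocalRing.mem_maximalIdeal _).mp h (IsLocalization.map_units L s))
    have hrs' : ((IsLocalization.mk' L r s : L) : F') = y := congrArg Subtype.val hrs
    have hcoe : ((IsLocalization.mk' L r s - algebraMap R L (eR (C x)) : L) : F') =
        y - algebraMap F F' (x : F) := by
      change ((IsLocalization.mk' L r s : L) : F') - ((algebraMap R L (eR (C x)) : L) : F') = _
      rw [hrs', halg, heR_apply, he_C, hιapply]
    have hmem : y - algebraMap F F' (x : F) ∈ L := by
      have h := (IsLocalization.mk' L r s - algebraMap R L (eR (C x))).2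
      rwa [hcoe] at h
    rw [hnon _ hmem]
    have key : (⟨y - algebraMap F F' (x : F), hmem⟩ : L) =
        IsLocalization.mk' L r s - algebraMap R L (eR (C x)) := Subtype.ext hcoe.symm
    rw [key]
    exact hmaxmem

end Literature.NumberTheory.DiophantineGeometry.AlgFunctionField

end
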